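import Summits.Ventures.KdS.SharpWindows
import Summits.Ventures.KdS.WindowConstantsB0
import HarnessLib

/-!
# Venture KdS — B0 with the hypothesis-free scalar windows: `tableB0u` (A26′) and the sharp μ = 0 squares

HONEST FRAMING (venture `Summits/Ventures/KdS`, cell `pub-kds`; lead 07:57:43Z PLAN A26′, A40 (ii)):
bookkeeping. On the pilot box B0 the hypothesis-free window constants of `SharpWindows.lean` are PROVED
from `horizonAngVel_rPlus_B0 : ϖ₁ ≤ 7/50` (`WindowConstantsB0.lean`): for the upgrade scalar table
`tableB0u` (`R_u = h0_u = 4/25` for `|m| = 1`, `8/25` otherwise; `|m|·7/50 ≤ R_u(m)`) and for the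
μ = 0 squares `R0B0` (`3/20, 1/5, 1/3`; `|m|·7/50 ≤ R0B0 m`). Consequences:
`msTruncScalarU_B0 : StatementBbarScalar B0 tableB0u (1/125) Λs → MSTruncScalar B0 tableB0u Λs` (the
rectangles `Λs` of eng-3's runs 7u/8u are a parameter until filed) and `windowConstants0'_B0` (the sharp
μ = 0 clause holds for `R0B0`; the μ = 0 box statement itself is already `msTrunc0B0_of_certificates` of
`WindowConstantsB0.lean`, so it is not re-proved here). No claim about mode stability beyond these
implications.
-/

noncomputable section

open Set

namespace Summit.Ventures.KdS

open Literature.Geometry.Lorentzian Literature.Geometry.Lorentzian.KerrDeSitter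

/-- Upgrade half-widths = heights (PLAN A26′): `4/25` for `|m| = 1`, `8/25` otherwise. -/
def widthB0u (m : ℝ) : ℝ := if |m| = 1 then 4 / 25 else 8 / 25

/-- The upgrade scalar table on B0: `M0 = 2`, `R = h0 = widthB0u` (the `s = -2` height slot is unused
here; set to `3/20`). -/
def tableB0u : WindowTable := ⟨2, widthB0u, 3 / 20, widthB0u⟩

section Box

variable {a Λ : ℝ} (ha : 1 / 2 ≤ a ∧ a ≤ 251 / 500) (hΛ : 1 / 50 ≤ Λ ∧ Λ ≤ 101 / 5000)
include ha hΛ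

/-- On B0: `|m|·ϖ₁ ≤ 2·(7/50)` for `|m| ≤ 2`. -/
theorem abs_mul_varpiEvent_B0 {m : ℝ} (hm : |m| ≤ 2) :
    |m| * horizonAngVel a (rPlus 1 a Λ) ≤ 2 * (7 / 50) ∧
      (|m| = 1 → |m| * horizonAngVel a (rPlus 1 a Λ) ≤ 7 / 50) := by
  obtain ⟨hϖ0, hϖ⟩ := horizonAngVel_rPlus_B0 ha hΛ
  refine ⟨mul_le_mul hm hϖ hϖ0 (by norm_num), fun h1 => ?_⟩
  rw [h1, one_mul]; exact hϖ

end Box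

/-- **(H4u) on B0 — PROVED**: `|m|·ϖ₁ ≤ 7/50 ≤ 4/25` (`|m| = 1`), `≤ 7/25 ≤ 8/25` (`|m| ≤ 2`). -/
theorem windowConstantsScalarU_B0 : WindowConstantsScalarU B0 tableB0u := by
  rintro ⟨M, a, Λ⟩ ⟨hM, ha, hΛ⟩
  simp only at hM ha hΛ
  subst hM
  have ha' : 1 / 2 ≤ a ∧ a ≤ 251 / 500 := ⟨ha.1, ha.2⟩
  have hΛ' : 1 / 50 ≤ Λ ∧ Λ ≤ 101 / 5000 := ⟨hΛ.1, hΛ.2⟩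
  obtain ⟨hsub, -, -, -, -⟩ := horizons_B0 ha' hΛ'
  refine ⟨hsub, by linarith [ha.1], ?_⟩
  intro m hm _hm0
  change |m| ≤ 2 at hm
  obtain ⟨h2, h1⟩ := abs_mul_varpiEvent_B0 ha' hΛ' hm
  show |m| * horizonAngVel a (rPlus 1 a Λ) ≤ widthB0u m ∧ |m| * horizonAngVel a (rPlus 1 a Λ) ≤ widthB0u m
  rw [and_self]
  unfold widthB0u
  split_ifs with h
  · linarith [h1 h]
  · linarith

/-- **The hypothesis-free scalar B0 statement (A26′).** For ANY family of rectangles `Λs` (eng-3's runs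
7u/8u records, once filed), the certificates' Statement B̄ on the upgrade windows gives `MSTruncScalar`
outright. -/
theorem msTruncScalarU_B0 {Λs : ℝ → ℝ → ℂ → ℝ → Set ℂ}
    (hB : StatementBbarScalar B0 tableB0u (1 / 125) Λs) : MSTruncScalar B0 tableB0u Λs :=
  msTruncScalarU_of windowConstantsScalarU_B0 (by norm_num) hB

/-- **(H4₀′) on B0 — PROVED** for the filed squares `R0B0` (`3/20, 1/5, 1/3`): `|m|·ϖ₁ ≤ R0B0 m`. -/
theorem windowConstants0'_B0 : WindowConstants0' B0 2 R0B0 := by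
  rintro ⟨M, a, Λ⟩ ⟨hM, ha, hΛ⟩
  simp only at hM ha hΛ
  subst hM
  have ha' : 1 / 2 ≤ a ∧ a ≤ 251 / 500 := ⟨ha.1, ha.2⟩
  have hΛ' : 1 / 50 ≤ Λ ∧ Λ ≤ 101 / 5000 := ⟨hΛ.1, hΛ.2⟩
  obtain ⟨hsub, -, -, -, -⟩ := horizons_B0 ha' hΛ'
  obtain ⟨hϖ0, -⟩ := horizonAngVel_rPlus_B0 ha' hΛ'
  refine ⟨hsub, by linarith [ha.1], ?_⟩
  intro m hm
  obtain ⟨h2, h1⟩ := abs_mul_varpiEvent_B0 ha' hΛ' hm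
  show 0 ≤ R0B0 m ∧ |m| * horizonAngVel a (rPlus 1 a Λ) ≤ R0B0 m
  unfold R0B0
  split_ifs with h0 h1'
  · refine ⟨by norm_num, ?_⟩
    rw [h0]; norm_num
  · exact ⟨by norm_num, by linarith [h1 h1']⟩
  · exact ⟨by norm_num, by linarith⟩

end Summit.Ventures.KdS

end
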